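import Literature.AlgebraicGeometry.Modules.VanishingLocusOfHom
import Literature.AlgebraicGeometry.Modules.SheafHomFrames
import HarnessLib

/-!
# Zero schemes and vanishing loci for finite locally free targets: the hypothesis-free forms

Topic `Literature/AlgebraicGeometry/Modules`, namespace `Literature.AlgebraicGeometry.Modules`.  THEOREMS ONLY; no definition, no
named fact, no instance, no notation, no `sorry`.

★ `Modules/ZeroSchemeUniversal` (p757588) and ★ `Modules/VanishingLocusOfHom` (p758240) carry the side hypotheses
`(F : FrameSystem V)` / `(hV : IsAffineLocalizing (dual V))` / `(hE : IsAffineLocalizing E)`.  For `V` finite locally free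
(`IsFiniteLocallyFree V`) the first two are automatic — `frameSystemOfIsFiniteLocallyFree`, and **the dual of a finite locally
free module is finite locally free (★ `isFiniteLocallyFree_dual`), hence a vector bundle (★ `IsFiniteLocallyFree.isVectorBundle`),
hence quasi-coherent, hence affine-localizing (★ `IsAffineLocalizing.of_isQuasicoherent`)** — and `hE` holds for `E`
quasi-coherent.  This file records the discharges (`isAffineLocalizing_of_isFiniteLocallyFree`,
`isAffineLocalizing_dual_of_isFiniteLocallyFree`) and the resulting hypothesis-free universal properties:

* `zeroSchemeIdeal_le_ker_iff'`, `existsUnique_comp_zeroSchemeι_eq_iff'` — the zero scheme of a section of a vector bundle;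
* `vanishingIdeal_le_ker_iff'`, `exists_comp_vanishing_subschemeι_eq_iff'`, `existsUnique_comp_vanishing_subschemeι_eq_iff'` —
  the vanishing locus of `u : 𝓔 ⟶ 𝓥`, `𝓔` quasi-coherent, `𝓥` finite locally free.

Cell `hodgecm-mathlib`, (h6) (price sheet v0.4 §5b (6)); consumers (h6-b2) ★ `Morphisms/ContainmentLocusClosed` (B-p15) and (h6-d).
HC_CM is proved only modulo the 7 printed citations until rung 0 closes; nothing here is about HC.

## References
* [Fulton1998] W. Fulton, *Intersection Theory*, 2nd ed. (1998), App. B.3.2, B.3.4 (PDF p. 410).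
* [Hartshorne1977] R. Hartshorne, *Algebraic Geometry*, GTM 52 (1977), II Prop. 5.9 (PDF p. 146), II Lemma 5.3 (PDF p. 141), II Ex. 5.1 (b).
-/

noncomputable section

-- `TopCat.Presheaf`/`Scheme.Modules` are not reducible (as in Mathlib's `AlgebraicGeometry/Modules`).
set_option backward.isDefEq.respectTransparency false

universe u

open CategoryTheory CategoryTheory.Limits AlgebraicGeometry TopologicalSpace Opposite

namespace Literature.AlgebraicGeometry.Modules

open Literature.AlgebraicGeometry.Motives

variable {X T : Scheme.{u}} (g : T ⟶ X) {E V : X.Modules}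

/-! ### The discharges -/

/-- **A finite locally free module is affine-localizing** (it is a vector bundle, ★ `IsFiniteLocallyFree.isVectorBundle`, hence
quasi-coherent, ★ `IsAffineLocalizing.of_isQuasicoherent`). [cite: Hartshorne1977, II Lemma 5.3 (PDF p. 141)] -/
theorem isAffineLocalizing_of_isFiniteLocallyFree (hV : IsFiniteLocallyFree V) : IsAffineLocalizing V := by
  haveI := hV.isVectorBundle.1
  exact IsAffineLocalizing.of_isQuasicoherent V

/-- **The dual of a finite locally free module is affine-localizing** (★ `isFiniteLocallyFree_dual` +
`isAffineLocalizing_of_isFiniteLocallyFree`). [cite: Hartshorne1977, II Ex. 5.1 (b)] [cite: Hartshorne1977, II Lemma 5.3 (PDF p. 141)] -/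
theorem isAffineLocalizing_dual_of_isFiniteLocallyFree (hV : IsFiniteLocallyFree V) : IsAffineLocalizing (dual V) :=
  isAffineLocalizing_of_isFiniteLocallyFree (isFiniteLocallyFree_dual hV)

/-! ### The zero scheme of a section of a vector bundle -/

/-- **`𝓘_{Z(t)} ≤ ker g^♯ ↔ η_g(t) = 0`** for a section `t` of a finite locally free `V` (★ `zeroSchemeIdeal_le_ker_iff` with both
side hypotheses discharged). [cite: Fulton1998, B.3.2 and B.3.4 (PDF p. 410)] -/
theorem zeroSchemeIdeal_le_ker_iff' (hV : IsFiniteLocallyFree V) (t : Γ(V, ⊤)) :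
    zeroSchemeIdeal V t ≤ g.ker ↔ unitSection g V ⊤ t = 0 :=
  zeroSchemeIdeal_le_ker_iff g (frameSystemOfIsFiniteLocallyFree hV) (isAffineLocalizing_dual_of_isFiniteLocallyFree hV) t

/-- **The zero scheme of a section of a vector bundle represents its vanishing locus** (unique factorisation; ★
`existsUnique_comp_zeroSchemeι_eq_iff`, hypotheses discharged). [cite: Fulton1998, B.3.2 (PDF p. 410)]
[cite: Hartshorne1977, II Prop. 5.9 (PDF p. 146)] -/
theorem existsUnique_comp_zeroSchemeι_eq_iff' (hV : IsFiniteLocallyFree V) (t : Γ(V, ⊤)) :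
    (∃! g' : T ⟶ zeroScheme V t, g' ≫ zeroSchemeι V t = g) ↔ unitSection g V ⊤ t = 0 :=
  existsUnique_comp_zeroSchemeι_eq_iff g (frameSystemOfIsFiniteLocallyFree hV)
    (isAffineLocalizing_dual_of_isFiniteLocallyFree hV) t

/-! ### The vanishing locus of a morphism into a vector bundle -/

variable (u : E ⟶ V)

/-- **`vanishingIdeal u ≤ ker g^♯ ↔ g^*u = 0`** for `u : 𝓔 ⟶ 𝓥` with `𝓔` quasi-coherent and `𝓥` finite locally free (★
`vanishingIdeal_le_ker_iff`, hypotheses discharged). [cite: Fulton1998, B.3.4 (PDF p. 410)] [cite: Hartshorne1977, II Prop. 5.9 (PDF p. 146)] -/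
theorem vanishingIdeal_le_ker_iff' [E.IsQuasicoherent] (hV : IsFiniteLocallyFree V) :
    vanishingIdeal u ≤ g.ker ↔ (Scheme.Modules.pullback g).map u = 0 :=
  vanishingIdeal_le_ker_iff u g (frameSystemOfIsFiniteLocallyFree hV) (IsAffineLocalizing.of_isQuasicoherent E)
    (isAffineLocalizing_dual_of_isFiniteLocallyFree hV)

/-- **`g` factors through the vanishing locus `V(u)` iff `g^*u = 0`** (`𝓔` quasi-coherent, `𝓥` finite locally free).
[cite: Hartshorne1977, II Prop. 5.9 (PDF p. 146)] -/
theorem exists_comp_vanishing_subschemeι_eq_iff' [E.IsQuasicoherent] (hV : IsFiniteLocallyFree V) :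
    (∃ g' : T ⟶ (vanishingIdeal u).subscheme, g' ≫ (vanishingIdeal u).subschemeι = g) ↔
      (Scheme.Modules.pullback g).map u = 0 :=
  exists_comp_subschemeι_eq_iff u g (frameSystemOfIsFiniteLocallyFree hV) (IsAffineLocalizing.of_isQuasicoherent E)
    (isAffineLocalizing_dual_of_isFiniteLocallyFree hV)

/-- **The vanishing locus `V(u)` represents `T ↦ {g | g^*u = 0}`** (unique factorisation; `𝓔` quasi-coherent, `𝓥` finite locally
free). [cite: Hartshorne1977, II Prop. 5.9 (PDF p. 146)] -/
theorem existsUnique_comp_vanishing_subschemeι_eq_iff' [E.IsQuasicoherent] (hV : IsFiniteLocallyFree V) :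
    (∃! g' : T ⟶ (vanishingIdeal u).subscheme, g' ≫ (vanishingIdeal u).subschemeι = g) ↔
      (Scheme.Modules.pullback g).map u = 0 :=
  existsUnique_comp_subschemeι_eq_iff u g (frameSystemOfIsFiniteLocallyFree hV) (IsAffineLocalizing.of_isQuasicoherent E)
    (isAffineLocalizing_dual_of_isFiniteLocallyFree hV)

/-- **The ideal sheaf of `V(u)` on affines, hypothesis-free form**: for `𝓔` quasi-coherent and `𝓥` finite locally free,
`(vanishingIdeal u).ideal W = ⟨μ_W(u_W(s))⟩` on every affine `W` (★ `vanishingIdeal_ideal`). [cite: Fulton1998, B.3.4 (PDF p. 410)] -/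
theorem vanishingIdeal_ideal' [E.IsQuasicoherent] (hV : IsFiniteLocallyFree V) (W : X.affineOpens) :
    (vanishingIdeal u).ideal W = vanishingValueIdeal u W :=
  vanishingIdeal_ideal u (IsAffineLocalizing.of_isQuasicoherent E) (isAffineLocalizing_dual_of_isFiniteLocallyFree hV) W

end Literature.AlgebraicGeometry.Modules

end
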